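import Summits.FinalStateConjecture.FinalStateConjecture.Theses.LogTimeThreeAnnuli
import Summits.FinalStateConjecture.FinalStateConjecture.Theses.ExactKerrEnds
import Summits.FinalStateConjecture.FinalStateConjecture.Theorems.LogTimeThreeAnnuliSubconvergentEraGenericOfSettledAllOrders
import Summits.FinalStateConjecture.FinalStateConjecture.Theorems.LogTimeThreeAnnuliSubconvergentEraGenericAlongKerrEndsWindow
import Literature.Geometry.Lorentzian.TameGenericityDiagonal
import Literature.Geometry.Lorentzian.ExactKerrEnd
import HarnessLib

/-!
# Crux `LogTimeThreeAnnuli.SubconvergentEraGeneric` (stmt-FinalStateConjecture-17490) AT FINITE ORDER `K₀ = 2`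
# follows from THREE EXISTING ITEMS of route `ExactKerrEnds` — the "option C" door, kernel-checked

A `--supports` record of the line `Cruxes/SubconvergentEraGeneric/Lines/birth.lean` (lead c7, 2026-08-17).  The crux asks for
TAME Christodoulou genericity (codimension `1`) of the property `P` = "every MGHD has complete `𝓘⁺` and carries an honest
subconvergent final era" whose two convergence clauses are quantified over EVERY differentiation order `k` (flat zone `→ η`
in every `Cᵏ`; windowed `Cᵏ`-closeness of the near zones on fixed and growing slabs).  The crux's vetting refuter
(VETTING.md §6, 2026-08-17) and lead c2 (K_HONESTY_AUDIT.md §5) proposed the finite-order repair `C′(K₀)`: the same property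
with both `∀ k` clauses cut to `k ≤ K₀`.  Lead c4 landed its pointwise kernel content `era_upTo_of_settled` (a `Cᵏ⁰`-settled
development in the Statement's vocabulary carries the era up to order `k₀`).  This file closes the loop at the level of
TAME GENERICITY, for `K₀ = 2` — the order at which a producer EXISTS in the tree:

* `subconvergentEraUpToTwo_of_settled` (pointwise): the Statement's `C²` settled clause for a datum (every MGHD: complete
  `𝓘⁺`, a `FinalStateDecomposition 𝒟 O 2` with sub-extremal holes, `O = exteriorOf charted`, `RaysStayInClosure`,
  `HasExhaustiveCharts`, `IsFutureOriented`) implies `P` cut at order `2` (`P≤₂`), verbatim.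
* `subconvergentEraGenericUpToTwo_of_exactKerrEndsItems` :
  `TameEscapeToKerrEnds → CensorshipAlongKerrEnds → SettlingAlongCensoredKerrEnds → tame-generic(P≤₂)` — the crux restated at
  order `2` follows from items stmt-18522 (E), stmt-18521 (C₁) and stmt-18520 (C₂ of `ExactKerrEnds`) BY NAME: at an
  admissible datum exceptional for `P≤₂`, the genuine censored Kerr-ended curve of `exists_censoredKerrEndedCurve` (E ∧ C₁
  pointed, p166919) is handed to `SettlingAlongCensoredKerrEnds`, whose settled output curve is a `P≤₂`-curve pointwise.
* `subconvergentEraGenericUpToTwo_of_subconvergentEraGeneric` : the crux implies its order-`2` cut (monotonicity in the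
  property) — the restatement only weakens.

Reading for the planner (LINE-STATE-c4/c5/c6 option C): restating stmt-17490 at `K₀ = 2` makes its import the conjunction
of three EXISTING items and files NO new open-problem item; the all-orders surplus of the crux as filed (the registered
residual C₂ʷ, `stub_subconvergentEraAlongCensoredKerrEndsWindow`) is exactly what separates it from the sibling route.  No
analysis is claimed and nothing is credited towards E, C₁, C₂ or the crux: the three items stay OPEN.
Sources: Christodoulou, CQG 16 (1999) A23, p. A24 (genericity as positive codimension; curves `α₀ + c f`); Klainerman,
"Brief introduction to the nonlinear stability of Kerr" (2025) §2.3 (asymptotic ⇒ orbital closeness); Corvino–Schoen,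
JDG 73 (2006) 185, Thm. 4 (Kerr-ended data).
-/

noncomputable section

-- the doubled `FinalStateConjecture` path component is the summit/problem naming scheme
set_option linter.dupNamespace false

namespace Summit.FinalStateConjecture.FinalStateConjecture.Theorems.LogTimeThreeAnnuli.SubconvergentEraGeneric

open scoped Manifold ContDiff Topology ENNReal
open Filter Set Function Literature.Geometry.Lorentzian
open Summit.FinalStateConjecture (HasCompleteNullInfinity exteriorOf RaysStayInClosure IsOrthochronous HasExhaustiveCharts
  IsFutureOriented)
open Literature.Geometry.Lorentzian.InitialDataSet (IsTameDataFamily IsImmersedAtZero IsTameChristodoulouGeneric)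
open Summit.FinalStateConjecture.FinalStateConjecture.Theses.LogTimeThreeAnnuli (SubconvergentEraGeneric)
open Summit.FinalStateConjecture.FinalStateConjecture.Theses.ExactKerrEnds (TameEscapeToKerrEnds CensorshipAlongKerrEnds
  SettlingAlongCensoredKerrEnds)

/-- **Settled in the Statement's vocabulary (`C²`) ⇒ the crux's property cut at order `2`, per datum.**  Every maximal
development with complete `𝓘⁺` and the Statement's settled clause (a `FinalStateDecomposition 𝒟 O 2` with sub-extremal holes,
`O = exteriorOf charted`, `RaysStayInClosure`, `HasExhaustiveCharts`, `IsFutureOriented`) carries the honest subconvergent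
era of `LogTimeThreeAnnuli.SubconvergentEraGeneric` with both `∀ k` clauses restricted to `k ≤ 2` (`era_upTo_of_settled` at
`k₀ = 2`).  Klainerman 2025 §2.3. [cite: Klainerman2025, §2.3] -/
theorem subconvergentEraUpToTwo_of_settled {X : Type} [TopologicalSpace X] [ChartedSpace E3 X] [IsManifold (𝓡 3) ∞ X]
    [ConnectedSpace X] {D : InitialDataSet (𝓡 3) X}
    (h : ∀ 𝒟 : VacuumCauchyDevelopment D, 𝒟.IsMaximal → HasCompleteNullInfinity 𝒟.toCauchyDevelopment ∧ ∃ (O : Set 𝒟.carrier) (d : FinalStateDecomposition 𝒟.toSpacetime O 2), (∀ i, Kerr.IsSubextremal (d.mass i) (d.spin i)) ∧ O = exteriorOf 𝒟.toCauchyDevelopment d.charted ∧ RaysStayInClosure 𝒟.toCauchyDevelopment O ∧ HasExhaustiveCharts d ∧ IsFutureOriented d) :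
    ∀ 𝒟 : VacuumCauchyDevelopment D, 𝒟.IsMaximal → HasCompleteNullInfinity 𝒟.toCauchyDevelopment ∧ (∃ (m₀ χ : ℝ) (O : Set 𝒟.carrier) (d : QuasiFinalStateDecomposition 𝒟.toSpacetime O 2 ⊤) (R : Fin d.N → ℝ → ℝ), 0 < m₀ ∧ χ < 1 ∧ O = exteriorOf 𝒟.toCauchyDevelopment d.charted ∧ RaysStayInClosure 𝒟.toCauchyDevelopment O ∧ (∀ i, Tendsto (R i) atTop atTop ∧ ∀ τ, max (Kerr.rPlus (d.mass i) (d.spin i)) 0 + 1 ≤ R i τ) ∧ (∀ τ₁, d.τ₀ < τ₁ → O \ d.certifiedLate R τ₁ ⊆ 𝒟.metric.causalPast 𝒟.timeOrientation (d.certifiedSlab R τ₁)) ∧ (∀ i, IsOrthochronous (d.motion i).1) ∧ (∀ i (ρ : ℝ), ∀ᶠ τ in atTop, ∀ x ∈ (d.background i).truncTimeSlab ρ τ, ∀ w : E4, 𝒟.timeOrientation.IsFutureDirected (mfderiv 𝓘(ℝ, E4) (𝓡 4) (d.chart i) x w) → 0 < ((d.motion i).1 : E4 ≃L[ℝ] E4).symm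 w 0) ∧ (∀ᶠ τ in atTop, ∀ x ∈ (Minkowski.backgroundOn d.flatDomain).timeSlab τ, 𝒟.timeOrientation.IsFutureDirected (mfderiv 𝓘(ℝ, E4) (𝓡 4) d.flatChart x (E4.basisVector 0))) ∧ (∀ k ≤ 2, Tendsto (fun τ => 𝒟.toSpacetime.deviationCk (Minkowski.backgroundOn d.flatDomain) d.flatChart k τ) atTop (𝓝 0)) ∧ (∀ i, ∀ k ≤ 2, ∀ (ρ : ℝ) (ε : ℝ≥0∞), 0 < ε → ∀ᶠ τ in atTop, ∃ M a, m₀ ≤ M ∧ M ≤ m₀⁻¹ ∧ |a| ≤ χ * M ∧ 𝒟.toSpacetime.truncDeviationCk ⟨(d.background i).domain, boostedKerrBilin (d.motion i).1 (d.motion i).2 M a, (d.background i).time, (d.background i).radius⟩ (d.chart i) k ρ τ ≤ ε ∧ 𝒟.toSpacetime.truncDeviationCk ⟨(d.background i).domain, boostedKerrBilin (d.motion i).1 (d.motion i).2 M a, (d.background i).time, (d.background i).radius⟩ (d.chart i) k (R i τ) τ ≤ ε)) := by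
  intro 𝒟 hmax
  obtain ⟨hscri, O, d, hsub, hO, hrays, hexh, hor⟩ := h 𝒟 hmax
  exact ⟨hscri, era_upTo_of_settled 𝒟 O le_rfl d hsub hO hrays hexh hor⟩

/-- **THE OPTION C DOOR: the crux restated at order `K₀ = 2` follows from three EXISTING items by name.**
`TameEscapeToKerrEnds` (stmt-FinalStateConjecture-18522) → `CensorshipAlongKerrEnds` (stmt-FinalStateConjecture-18521) →
`SettlingAlongCensoredKerrEnds` (stmt-FinalStateConjecture-18520) → the property "every MGHD has complete `𝓘⁺` and carries the
honest subconvergent era with its convergence clauses cut at order `2`" is tame-Christodoulou-generic of codimension `1` in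
`admissibleVacuumData X`.  Proof: at an admissible datum `d` exceptional for the cut property, `exists_censoredKerrEndedCurve`
(E ∧ C₁ pointed) gives a tame, injective, immersed curve of admissible data through `d` with Kerr-ended censored members off
`0` (the let-bound `KerrEnded` legend of `ExactKerrEnds` is `InitialDataSet.HasExactKerrEnd` verbatim); C₂ of `ExactKerrEnds`
hands back a tame injective immersed admissible curve through `d` whose members off `0` are `C²`-settled, hence satisfy the
cut property (`subconvergentEraUpToTwo_of_settled`); that curve is the witness.  Christodoulou, CQG 16 (1999) A23, p. A24.
[cite: Christodoulou1999, p. A24] -/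
theorem subconvergentEraGenericUpToTwo_of_exactKerrEndsItems :
    TameEscapeToKerrEnds → CensorshipAlongKerrEnds → SettlingAlongCensoredKerrEnds →
      ∀ (X : Type) [TopologicalSpace X] [ChartedSpace E3 X] [IsManifold (𝓡 3) ∞ X] [T2Space X] [SecondCountableTopology X] [ConnectedSpace X], IsTameChristodoulouGeneric (admissibleVacuumData X) (fun D => ∀ 𝒟 : VacuumCauchyDevelopment D, 𝒟.IsMaximal → HasCompleteNullInfinity 𝒟.toCauchyDevelopment ∧ (∃ (m₀ χ : ℝ) (O : Set 𝒟.carrier) (d : QuasiFinalStateDecomposition 𝒟.toSpacetime O 2 ⊤) (R : Fin d.N → ℝ → ℝ), 0 < m₀ ∧ χ < 1 ∧ O = exteriorOf 𝒟.toCauchyDevelopment d.charted ∧ RaysStayInClosure 𝒟.toCauchyDevelopment O ∧ (∀ i, Tendsto (R i) atTop atTop ∧ ∀ τ, max (Kerr.rPlus (d.mass i) (d.spin i)) 0 + 1 ≤ R i τ) ∧ (∀ τ₁, d.τ₀ < τ₁ → O \ d.certifiedLate R τ₁ ⊆ 𝒟.metric.causalPast 𝒟.timeOrientation (d.certifiedSlab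 R τ₁)) ∧ (∀ i, IsOrthochronous (d.motion i).1) ∧ (∀ i (ρ : ℝ), ∀ᶠ τ in atTop, ∀ x ∈ (d.background i).truncTimeSlab ρ τ, ∀ w : E4, 𝒟.timeOrientation.IsFutureDirected (mfderiv 𝓘(ℝ, E4) (𝓡 4) (d.chart i) x w) → 0 < ((d.motion i).1 : E4 ≃L[ℝ] E4).symm w 0) ∧ (∀ᶠ τ in atTop, ∀ x ∈ (Minkowski.backgroundOn d.flatDomain).timeSlab τ, 𝒟.timeOrientation.IsFutureDirected (mfderiv 𝓘(ℝ, E4) (𝓡 4) d.flatChart x (E4.basisVector 0))) ∧ (∀ k ≤ 2, Tendsto (fun τ => 𝒟.toSpacetime.deviationCk (Minkowski.backgroundOn d.flatDomain) d.flatChart k τ) atTop (𝓝 0)) ∧ (∀ i, ∀ k ≤ 2, ∀ (ρ : ℝ) (ε : ℝ≥0∞), 0 < ε → ∀ᶠ τ in atTop, ∃ M a, m₀ ≤ M ∧ M ≤ m₀⁻¹ ∧ |a| ≤ χ * M ∧ 𝒟.toSpacetime.truncDeviationCk ⟨(d.background i).domain, boostedKerrBilin (d.motion i).1 (d.motion i).2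 M a, (d.background i).time, (d.background i).radius⟩ (d.chart i) k ρ τ ≤ ε ∧ 𝒟.toSpacetime.truncDeviationCk ⟨(d.background i).domain, boostedKerrBilin (d.motion i).1 (d.motion i).2 M a, (d.background i).time, (d.background i).radius⟩ (d.chart i) k (R i τ) τ ≤ ε))) 1 := by
  intro hE hC hS X _ _ _ _ _ _ d hd
  obtain ⟨hd𝓓, hdP⟩ := hd
  obtain ⟨e, F, hF, h0, hinj, himm, hadm, hQ⟩ := exists_censoredKerrEndedCurve hE hC X d hd𝓓
  obtain ⟨e', F', hF', h0', hinj', himm', hadm', hS'⟩ :=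
    hS X e F hF (Or.inl ⟨himm, hinj⟩) hadm (fun c hc => hQ c hc)
  refine ⟨e', F', hF', himm', h0'.trans h0, hinj', hadm', fun c hc hmem => hmem.2 ?_⟩
  exact subconvergentEraUpToTwo_of_settled (hS' c hc)

/-- **The restatement only weakens: the crux implies its order-`2` cut** (monotonicity of tame genericity in the property:
the all-orders clauses specialise to `k ≤ 2`). [folklore] -/
theorem subconvergentEraGenericUpToTwo_of_subconvergentEraGeneric :
    SubconvergentEraGeneric → ∀ (X : Type) [TopologicalSpace X] [ChartedSpace E3 X] [IsManifold (𝓡 3) ∞ X] [T2Space X] [SecondCountableTopology X] [ConnectedSpace X], IsTameChristodoulouGeneric (admissibleVacuumData X) (fun D => ∀ 𝒟 : VacuumCauchyDevelopment D, 𝒟.IsMaximal → HasCompleteNullInfinity 𝒟.toCauchyDevelopment ∧ (∃ (m₀ χ : ℝ) (O : Set 𝒟.carrier) (d : QuasiFinalStateDecomposition 𝒟.toSpacetime O 2 ⊤) (R : Fin d.N → ℝ → ℝ), 0 < m₀ ∧ χ < 1 ∧ O = exteriorOf 𝒟.toCauchyDevelopment d.charted ∧ RaysStayInClosure 𝒟.toCauchyDevelopment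 O ∧ (∀ i, Tendsto (R i) atTop atTop ∧ ∀ τ, max (Kerr.rPlus (d.mass i) (d.spin i)) 0 + 1 ≤ R i τ) ∧ (∀ τ₁, d.τ₀ < τ₁ → O \ d.certifiedLate R τ₁ ⊆ 𝒟.metric.causalPast 𝒟.timeOrientation (d.certifiedSlab R τ₁)) ∧ (∀ i, IsOrthochronous (d.motion i).1) ∧ (∀ i (ρ : ℝ), ∀ᶠ τ in atTop, ∀ x ∈ (d.background i).truncTimeSlab ρ τ, ∀ w : E4, 𝒟.timeOrientation.IsFutureDirected (mfderiv 𝓘(ℝ, E4) (𝓡 4) (d.chart i) x w) → 0 < ((d.motion i).1 : E4 ≃L[ℝ] E4).symm w 0) ∧ (∀ᶠ τ in atTop, ∀ x ∈ (Minkowski.backgroundOn d.flatDomain).timeSlab τ, 𝒟.timeOrientation.IsFutureDirected (mfderiv 𝓘(ℝ, E4) (𝓡 4) d.flatChart x (E4.basisVector 0))) ∧ (∀ k ≤ 2, Tendsto (fun τ => 𝒟.toSpacetime.deviationCk (Minkowski.backgroundOn d.flatDomain) d.flatChart k τ) atTop (𝓝 0)) ∧ (∀ i, ∀ k ≤ 2,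 ∀ (ρ : ℝ) (ε : ℝ≥0∞), 0 < ε → ∀ᶠ τ in atTop, ∃ M a, m₀ ≤ M ∧ M ≤ m₀⁻¹ ∧ |a| ≤ χ * M ∧ 𝒟.toSpacetime.truncDeviationCk ⟨(d.background i).domain, boostedKerrBilin (d.motion i).1 (d.motion i).2 M a, (d.background i).time, (d.background i).radius⟩ (d.chart i) k ρ τ ≤ ε ∧ 𝒟.toSpacetime.truncDeviationCk ⟨(d.background i).domain, boostedKerrBilin (d.motion i).1 (d.motion i).2 M a, (d.background i).time, (d.background i).radius⟩ (d.chart i) k (R i τ) τ ≤ ε))) 1 := by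
  intro h X _ _ _ _ _ _
  refine (h X).mono fun D _ hP 𝒟 hmax => ?_
  obtain ⟨hscri, m₀, χ, O, d, R, hm₀, hχ, hO, hrays, hR, hexh, horth, hcov, hflat₀, hflat, hnear⟩ := hP 𝒟 hmax
  exact ⟨hscri, m₀, χ, O, d, R, hm₀, hχ, hO, hrays, hR, hexh, horth, hcov, hflat₀, fun k _ => hflat k,
    fun i k _ ρ ε hε => hnear i k ρ ε hε⟩

end Summit.FinalStateConjecture.FinalStateConjecture.Theorems.LogTimeThreeAnnuli.SubconvergentEraGeneric

end
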